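import Summits.BirchSwinnertonDyer.BirchSwinnertonDyer.Theorems.ShaPrimaryTransferFiniteShaComponentTransferOddDoor
import Literature.NumberTheory.EllipticCurves.TwoIsogenyShaTwoTorsionBound
import Literature.NumberTheory.EllipticCurves.TwoIsogenyShaTwoTorsionEqPhi
import HarnessLib

/-!
# BirchSwinnertonDyer / ShaPrimaryTransfer — crux `FiniteShaComponentTransfer` (stmt-BirchSwinnertonDyer-22356):
# THE ODD DOOR READ ON A DESCENT VIA `2`-ISOGENY (any number field)

Fourth helper file of prover seat `bsd-line-spt-p1` g13 (`--supports stmt-22356 --as helper`; namespace `…ShaPrimaryTransferOddDoor`).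
THEOREMS ONLY; no definition, no named fact, no `sorry`. BSD is NOT proved by any of this; T is unchanged.

A descent via `2`-isogeny on `V : y² = x³ + ax² + bx` (two-torsion normal form over a number field `K : Type`,
`φ : V → V'`, `φ̂` its dual) computes the two defects `L = #Ш(V)[φ] = #(Ш(V) ∩ im Ξ_V)` and
`L' = #Ш(V')[φ̂] = #(Ш(V') ∩ im Ξ_{V'})` (Selmer counts minus point counts, `TwoIsogenySelmerGroupSha`). The tree has
the bracket `L ≤ #Ш(V/K)[2] ≤ L · L'` (`TwoIsogenyShaTwoTorsionBound`), equality `Ш(V)[2] = Ш(V)[φ]` when `L' = 1`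
(`TwoIsogenyShaTwoTorsionEqPhi`), and — Cassels–Tate being a tree theorem — `#Ш(V/K)[2] = 2^{t_2(V) + 2m}` (`…OddDoor` §1).
Put together:

* §1 `one_le_shaCorank_two_of_dual_eq_bot_of_odd` — **a SHARP dual side (`L' = 1`) with an ODD φ-defect (`L = 2^d`, `d` odd)
  certifies `t_2(V) ≥ 1`, i.e. `Ш(V/K)[2^∞]` infinite** (the odd door in isogeny-descent currency; conjecturally never met);
  contrapositive `even_of_shaCorank_two_eq_zero_of_dual_eq_bot` — behind a closed door (`t_2(V) = 0`) a sharp dual side forces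
  the φ-defect exponent to be EVEN (`L = 4^a`).
* §2 `natCard_sha_torsionBy_two_eq_of_pow_four` — **closed door, `L = 4^a`, weak dual bound `L' ≤ 3` ⟹ `#Ш(V/K)[2] = L`**
  (`Ш(V)[2] = Ш(V)[φ]` WITHOUT sharpness of the dual side: the only power of `4` in `[L, 3L]` is `L`);
  `sha_inf_torsionBy_two_eq_sha_inf_range_of_pow_four` — the subgroup equality.
* §3 `two_le_natCard_dual_of_shaCorank_two_eq_zero_of_odd` — **closed door and ODD φ-defect (`L = 2^d`, `d` odd) ⟹ `L' ≥ 2`**: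
  the dual descent CANNOT be sharp — parity forces a non-trivial `φ̂`-defect on the isogenous curve; and
  `natCard_sha_torsionBy_two_eq_two_mul_of_odd` — if moreover `L' ≤ 3` then `#Ш(V/K)[2] = 2L` exactly.

These turn the routine outputs `(L, L')` of the tree's `2`-isogeny descents into statements about `t_2` and `#Ш[2]` with no
further input; `…OddDoorCurve346` is the instance `L = 4`, `L' ≤ 2`, `t_2 = 0 ⟹ #Ш[2] = 4`.

References: [SilvermanAEC2009] Thm. X.4.2(a), Prop. X.4.9, proof of Prop. X.6.2(c), Thm. X.4.14; [Cassels1962ArithmeticIV]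
Thm. 1.1; [Dokchitser2013ParityNotes] §2.
-/

-- D-0017: single-problem summit, so `Summit.BirchSwinnertonDyer.BirchSwinnertonDyer.…` repeats a namespace BY DESIGN.
set_option linter.dupNamespace false
set_option autoImplicit false

noncomputable section

open scoped Classical
open scoped AddSubgroup
open Literature.NumberTheory.EllipticCurves WeierstrassCurve
open Literature.Algebra.Module (natCard_torsionBy_addSubgroup)
open WeierstrassCurve.Affine (SqUnits)

namespace Summit.BirchSwinnertonDyer.BirchSwinnertonDyer.Theorems.ShaPrimaryTransferOddDoor

variable {K : Type} [Field K] [NumberField K] (V : WeierstrassCurve K) [V.IsTwoTorsionNF] [V.IsElliptic]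

/-- For powers of two: `2^d` is a perfect square iff `d` is even (`isSquare_prime_pow_iff` at `p = 2`). [folklore] -/
theorem isSquare_two_pow_iff {d : ℕ} : IsSquare (2 ^ d) ↔ Even d :=
  haveI : Fact (Nat.Prime 2) := ⟨Nat.prime_two⟩
  isSquare_prime_pow_iff 2

/-! ## §1 Sharp dual side: the φ-defect IS `#Ш[2]`, so its parity is the parity of `t_2` -/

/-- **A sharp dual descent with an ODD φ-defect certifies infinite `Ш`**: if `Ш(V') ∩ im Ξ_{V'} = ⊥` (`Ш(V')[φ̂] = 0`) and
`#(Ш(V) ∩ im Ξ_V) = 2^d` with `d` odd, then `t_2(V) ≥ 1` (`Ш(V)[2] = Ш(V)[φ]` by `TwoIsogenyShaTwoTorsionEqPhi`, and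
`#Ш[2] = 2^{t_2 + 2m}`). [cite: SilvermanAEC2009, proof of Prop. X.6.2(c)] [cite: Dokchitser2013ParityNotes, §2] -/
theorem one_le_shaCorank_two_of_dual_eq_bot_of_odd
    (hV' : V.twoIsogenyCodomain.sha ⊓
      AddMonoidHom.range (G := Additive (SqUnits K)) V.twoIsogenyCodomain.twoIsogenyTorsorHom = ⊥)
    {d : ℕ} (hL : Nat.card ↥(V.sha ⊓ AddMonoidHom.range (G := Additive (SqUnits K)) V.twoIsogenyTorsorHom) = 2 ^ d)
    (hodd : Odd d) : 1 ≤ V.shaCorank 2 := by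
  haveI : Fact (Nat.Prime 2) := ⟨Nat.prime_two⟩
  have hN : Nat.card (V.sha[(2 : ℤ)]) = 2 ^ d := by
    rw [natCard_torsionBy_addSubgroup, V.sha_inf_torsionBy_two_eq_sha_inf_range hV', hL]
  refine one_le_shaCorank_of_not_isSquare V 2 ?_
  rw [show ((2 : ℕ) : ℤ) = (2 : ℤ) from rfl, hN, isSquare_two_pow_iff]
  exact Nat.not_even_iff_odd.mpr hodd

/-- … hence `Ш(V/K)[2^∞]` is infinite. [cite: Dokchitser2013ParityNotes, §2] -/
theorem infinite_shaPrimary_two_of_dual_eq_bot_of_odd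
    (hV' : V.twoIsogenyCodomain.sha ⊓
      AddMonoidHom.range (G := Additive (SqUnits K)) V.twoIsogenyCodomain.twoIsogenyTorsorHom = ⊥)
    {d : ℕ} (hL : Nat.card ↥(V.sha ⊓ AddMonoidHom.range (G := Additive (SqUnits K)) V.twoIsogenyTorsorHom) = 2 ^ d)
    (hodd : Odd d) : Infinite ↥(AddCommGroup.primaryComponent V.sha 2) := by
  haveI : Fact (Nat.Prime 2) := ⟨Nat.prime_two⟩
  have h1 := one_le_shaCorank_two_of_dual_eq_bot_of_odd V hV' hL hodd
  rw [← not_finite_iff_infinite, finite_primaryComponent_sha_iff_shaCorank_eq_zero V 2]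
  omega

/-- **Behind a closed door a sharp dual side forces an EVEN φ-defect exponent**: `t_2(V) = 0`, `Ш(V')[φ̂] = 0`,
`#Ш(V)[φ] = 2^d ⟹ d` even. [cite: SilvermanAEC2009, Thm. X.4.14] [cite: Dokchitser2013ParityNotes, §2] -/
theorem even_of_shaCorank_two_eq_zero_of_dual_eq_bot (h0 : V.shaCorank 2 = 0)
    (hV' : V.twoIsogenyCodomain.sha ⊓
      AddMonoidHom.range (G := Additive (SqUnits K)) V.twoIsogenyCodomain.twoIsogenyTorsorHom = ⊥)
    {d : ℕ} (hL : Nat.card ↥(V.sha ⊓ AddMonoidHom.range (G := Additive (SqUnits K)) V.twoIsogenyTorsorHom) = 2 ^ d) :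
    Even d := by
  by_contra hd
  have h1 := one_le_shaCorank_two_of_dual_eq_bot_of_odd V hV' hL (Nat.not_even_iff_odd.mp hd)
  omega

/-! ## §2 Closed door, square φ-defect, WEAK dual bound: `Ш(V)[2] = Ш(V)[φ]` without sharpness -/

/-- The only power of `4` in `[4^a, 3·4^a]` is `4^a`. [folklore] -/
theorem pow_four_eq_of_mem_Icc {a m : ℕ} (h1 : 4 ^ a ≤ 4 ^ m) (h2 : 4 ^ m ≤ 3 * 4 ^ a) : m = a := by
  rcases Nat.lt_or_ge a m with hlt | hge
  · exfalso
    have h4 : 4 ^ (a + 1) ≤ 4 ^ m := Nat.pow_le_pow_right (by norm_num) hlt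
    rw [pow_succ] at h4
    have : 0 < 4 ^ a := by positivity
    omega
  · exact le_antisymm hge ((Nat.pow_le_pow_iff_right (by norm_num : 1 < 4)).mp h1)

/-- **`#Ш(V/K)[2] = #Ш(V)[φ]` from a closed door, a square φ-defect and a WEAK dual bound**: if `t_2(V) = 0`,
`#(Ш(V) ∩ im Ξ_V) = 4^a` and `#(Ш(V') ∩ im Ξ_{V'}) ≤ 3`, then `#Ш(V/K)[2] = 4^a` — Cassels–Tate makes `#Ш[2]` a power of `4`
and the bracket `[4^a, 3·4^a]` contains only one. (`TwoIsogenyShaTwoTorsionEqPhi` needs the dual side to be `1`.)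
[cite: SilvermanAEC2009, Thm. X.4.2(a) and Thm. X.4.14] [cite: Dokchitser2013ParityNotes, §2] -/
theorem natCard_sha_torsionBy_two_eq_of_pow_four (h0 : V.shaCorank 2 = 0) {a : ℕ}
    (hL : Nat.card ↥(V.sha ⊓ AddMonoidHom.range (G := Additive (SqUnits K)) V.twoIsogenyTorsorHom) = 4 ^ a)
    (hL' : Nat.card ↥(V.twoIsogenyCodomain.sha ⊓
      AddMonoidHom.range (G := Additive (SqUnits K)) V.twoIsogenyCodomain.twoIsogenyTorsorHom) ≤ 3)
    (hL'pos : 1 ≤ Nat.card ↥(V.twoIsogenyCodomain.sha ⊓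
      AddMonoidHom.range (G := Additive (SqUnits K)) V.twoIsogenyCodomain.twoIsogenyTorsorHom)) :
    Nat.card (V.sha[(2 : ℤ)]) = 4 ^ a := by
  haveI : Fact (Nat.Prime 2) := ⟨Nat.prime_two⟩
  haveI : Finite ↥(V.sha ⊓ AddMonoidHom.range (G := Additive (SqUnits K)) V.twoIsogenyTorsorHom) :=
    Nat.finite_of_card_ne_zero (by rw [hL]; positivity)
  haveI : Finite ↥(V.twoIsogenyCodomain.sha ⊓
      AddMonoidHom.range (G := Additive (SqUnits K)) V.twoIsogenyCodomain.twoIsogenyTorsorHom) :=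
    Nat.finite_of_card_ne_zero (by omega)
  have hup := V.natCard_sha_torsionBy_two_le_mul
  have hlow := V.natCard_sha_inf_range_le_natCard_sha_torsionBy_two
  obtain ⟨m, hm⟩ := exists_natCard_sha_torsionBy_eq_pow V 2
  rw [h0, zero_add, show ((2 : ℕ) : ℤ) = (2 : ℤ) from rfl, pow_mul, show (2 ^ 2 : ℕ) = 4 by norm_num] at hm
  rw [hm] at hup hlow ⊢
  rw [hL] at hup hlow
  have h2 : 4 ^ m ≤ 3 * 4 ^ a := hup.trans (by nlinarith)
  rw [pow_four_eq_of_mem_Icc hlow h2]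

/-- Subgroup form: under the same hypotheses **`Ш(V/K)[2] = Ш(V/K)[φ]`** in `H¹(K, V)`. [cite: SilvermanAEC2009, Thm. X.4.2(a)] -/
theorem sha_inf_torsionBy_two_eq_sha_inf_range_of_pow_four (h0 : V.shaCorank 2 = 0) {a : ℕ}
    (hL : Nat.card ↥(V.sha ⊓ AddMonoidHom.range (G := Additive (SqUnits K)) V.twoIsogenyTorsorHom) = 4 ^ a)
    (hL' : Nat.card ↥(V.twoIsogenyCodomain.sha ⊓
      AddMonoidHom.range (G := Additive (SqUnits K)) V.twoIsogenyCodomain.twoIsogenyTorsorHom) ≤ 3)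
    (hL'pos : 1 ≤ Nat.card ↥(V.twoIsogenyCodomain.sha ⊓
      AddMonoidHom.range (G := Additive (SqUnits K)) V.twoIsogenyCodomain.twoIsogenyTorsorHom)) :
    V.sha ⊓ AddSubgroup.torsionBy V.galH1 2 =
      V.sha ⊓ AddMonoidHom.range (G := Additive (SqUnits K)) V.twoIsogenyTorsorHom := by
  have hN := natCard_sha_torsionBy_two_eq_of_pow_four V h0 hL hL' hL'pos
  have hN' : Nat.card ↥(V.sha ⊓ AddSubgroup.torsionBy V.galH1 2) = 4 ^ a := by
    rw [← natCard_torsionBy_addSubgroup, hN]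
  haveI : Finite ↥(V.sha ⊓ AddSubgroup.torsionBy V.galH1 2) := Nat.finite_of_card_ne_zero (by rw [hN']; positivity)
  exact (AddSubgroup.eq_of_le_of_card_ge (V.sha_inf_range_twoIsogenyTorsorHom_le) (by rw [hL, hN'])).symm

/-! ## §3 Closed door and ODD φ-defect: the dual descent cannot be sharp -/

/-- **Parity propagates across the isogeny**: if `t_2(V) = 0` and `#(Ш(V) ∩ im Ξ_V) = 2^d` with `d` ODD, then
`#(Ш(V') ∩ im Ξ_{V'}) ≥ 2` — the `φ̂`-defect of the isogenous curve is non-trivial (`#Ш[2] = 4^m ≥ 2·2^d` needs room in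
the bracket `≤ 2^d · L'`). [cite: SilvermanAEC2009, Thm. X.4.2(a) and Thm. X.4.14] [cite: Dokchitser2013ParityNotes, §2] -/
theorem two_le_natCard_dual_of_shaCorank_two_eq_zero_of_odd (h0 : V.shaCorank 2 = 0) {d : ℕ}
    (hL : Nat.card ↥(V.sha ⊓ AddMonoidHom.range (G := Additive (SqUnits K)) V.twoIsogenyTorsorHom) = 2 ^ d)
    (hodd : Odd d)
    [Finite ↥(V.twoIsogenyCodomain.sha ⊓
      AddMonoidHom.range (G := Additive (SqUnits K)) V.twoIsogenyCodomain.twoIsogenyTorsorHom)] :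
    2 ≤ Nat.card ↥(V.twoIsogenyCodomain.sha ⊓
      AddMonoidHom.range (G := Additive (SqUnits K)) V.twoIsogenyCodomain.twoIsogenyTorsorHom) := by
  haveI : Fact (Nat.Prime 2) := ⟨Nat.prime_two⟩
  haveI : Finite ↥(V.sha ⊓ AddMonoidHom.range (G := Additive (SqUnits K)) V.twoIsogenyTorsorHom) :=
    Nat.finite_of_card_ne_zero (by rw [hL]; positivity)
  have hup := V.natCard_sha_torsionBy_two_le_mul
  have hlow := V.natCard_sha_inf_range_le_natCard_sha_torsionBy_two
  rw [hL] at hup hlow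
  by_contra hlt
  push Not at hlt
  have hle1 : Nat.card ↥(V.twoIsogenyCodomain.sha ⊓
      AddMonoidHom.range (G := Additive (SqUnits K)) V.twoIsogenyCodomain.twoIsogenyTorsorHom) ≤ 1 := by omega
  have hN : Nat.card (V.sha[(2 : ℤ)]) = 2 ^ d :=
    le_antisymm (hup.trans (by simpa using Nat.mul_le_mul_left (2 ^ d) hle1)) hlow
  have hsq : IsSquare (Nat.card (V.sha[(2 : ℤ)])) := isSquare_natCard_sha_torsionBy_of_shaCorank_eq_zero V 2 h0
  rw [hN, isSquare_two_pow_iff] at hsq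
  exact (Nat.not_even_iff_odd.mpr hodd) hsq

/-- **… and then `#Ш(V/K)[2] = 2 · #Ш(V)[φ]` if the dual defect is at most `3`**: `t_2(V) = 0`, `#(Ш(V) ∩ im Ξ_V) = 2^d`
with `d` odd, `#(Ш(V') ∩ im Ξ_{V'}) ≤ 3 ⟹ #Ш(V/K)[2] = 2^{d+1}` (the only power of `4` in `[2^d, 3·2^d]`).
[cite: SilvermanAEC2009, Thm. X.4.2(a) and Thm. X.4.14] [cite: Dokchitser2013ParityNotes, §2] -/
theorem natCard_sha_torsionBy_two_eq_two_mul_of_odd (h0 : V.shaCorank 2 = 0) {d : ℕ}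
    (hL : Nat.card ↥(V.sha ⊓ AddMonoidHom.range (G := Additive (SqUnits K)) V.twoIsogenyTorsorHom) = 2 ^ d)
    (hodd : Odd d)
    (hL' : Nat.card ↥(V.twoIsogenyCodomain.sha ⊓
      AddMonoidHom.range (G := Additive (SqUnits K)) V.twoIsogenyCodomain.twoIsogenyTorsorHom) ≤ 3)
    (hL'pos : 1 ≤ Nat.card ↥(V.twoIsogenyCodomain.sha ⊓
      AddMonoidHom.range (G := Additive (SqUnits K)) V.twoIsogenyCodomain.twoIsogenyTorsorHom)) :
    Nat.card (V.sha[(2 : ℤ)]) = 2 ^ (d + 1) := by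
  haveI : Fact (Nat.Prime 2) := ⟨Nat.prime_two⟩
  haveI : Finite ↥(V.sha ⊓ AddMonoidHom.range (G := Additive (SqUnits K)) V.twoIsogenyTorsorHom) :=
    Nat.finite_of_card_ne_zero (by rw [hL]; positivity)
  haveI : Finite ↥(V.twoIsogenyCodomain.sha ⊓
      AddMonoidHom.range (G := Additive (SqUnits K)) V.twoIsogenyCodomain.twoIsogenyTorsorHom) :=
    Nat.finite_of_card_ne_zero (by omega)
  have hup := V.natCard_sha_torsionBy_two_le_mul
  have hlow := V.natCard_sha_inf_range_le_natCard_sha_torsionBy_two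
  obtain ⟨m, hm⟩ := exists_natCard_sha_torsionBy_eq_pow V 2
  rw [h0, zero_add, show ((2 : ℕ) : ℤ) = (2 : ℤ) from rfl] at hm
  rw [hm] at hup hlow ⊢
  rw [hL] at hup hlow
  obtain ⟨k, rfl⟩ := hodd
  -- `2k+1 ≤ 2m < 2k+3`: from `2^(2k+1) ≤ 2^(2m) ≤ 3 · 2^(2k+1) < 2^(2k+3)`
  have hle : 2 * k + 1 ≤ 2 * m := (Nat.pow_le_pow_iff_right (by norm_num : 1 < 2)).mp hlow
  have h3 : 2 ^ (2 * k + 1) * 3 < 2 ^ (2 * k + 3) := by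
    have hp : 0 < 2 ^ (2 * k + 1) := by positivity
    rw [show 2 ^ (2 * k + 3) = 2 ^ (2 * k + 1) * 4 by ring]
    omega
  have hup' : 2 ^ (2 * m) < 2 ^ (2 * k + 3) :=
    lt_of_le_of_lt (hup.trans (Nat.mul_le_mul_left _ hL')) h3
  have hlt : 2 * m < 2 * k + 3 := (Nat.pow_lt_pow_iff_right (by norm_num : 1 < 2)).mp hup'
  have hmk : 2 * m = 2 * k + 1 + 1 := by omega
  rw [hmk]

end Summit.BirchSwinnertonDyer.BirchSwinnertonDyer.Theorems.ShaPrimaryTransferOddDoor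

end
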